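import Literature.Geometry.Manifold.CylinderSlice
import Literature.Geometry.Riemannian.SphericalCylinderEntropy
import Literature.Geometry.Riemannian.RoundSphere
import Literature.MeasureTheory.Hausdorff.SphereAreaGeneral
import Literature.Topology.FourManifolds.HomotopyS4CompactProofs
import HarnessLib

/-!
# Negative lemmas for crux `CylinderEntropy.CylinderRungTwo` (stmt-SmoothPoincare4-7631), line `killing-flux`:
# the flux identity (STUB 2 `FluxIdentity` of `Cruxes/CylinderRungTwo/Lines/killing-flux.lean`) is FALSE
# without the hypothesis `Continuous ν`, and FALSE without the absolute value

`FluxIdentity` (repaired per triage r1-1/2/3) says: for a compact connected cross-section `ι : M → N = S⁴ × ℝ ⊂ ℝ⁶`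
separating the ends and ANY continuous unit normal field `ν` along `ι` tangent to `N`,
`|∫_M ν₅ d(ι^* μH⁴)| = μH⁴(S⁴)`.  We record, as kernel-checked load-bearing facts for the provers of that stub:

* `fluxIdentityWithoutContinuous_false`: the continuity of `ν` cannot be dropped.  On the slice `S⁴ × {0}`
  (tree `CylinderSlice.sliceMap 0`; connected, separating) the field `ν = +e₅` on the open hemisphere `{x₀ > 0}`
  and `ν = -e₅` elsewhere satisfies every other hypothesis verbatim (it is POINTWISE a unit normal inside `N`),
  while its flux is `μ(H⁺) - μ(S⁴ ∖ H⁺)`, of absolute value `< μ(H⁺) + μ(S⁴ ∖ H⁺) = μH⁴(S⁴)` because both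
  parts contain a spherical cap of positive area (tree `le_euclideanHausdorffMeasure_cap_general`).  Moral: a
  proof of `FluxIdentity` must turn `Continuous ν` + `ConnectedSpace M` into a GLOBAL sign `ν = ± ν_N` before
  the divergence theorem; the pointwise constraints alone do not control the flux.
* `fluxIdentityWithoutAbs_false`: the absolute value cannot be dropped (the slice with the continuous normal
  `-e₅` has flux `-μH⁴(S⁴)`): the sign of the flux IS the orientation of `ν`.
* `flux_sliceMap_axis`: the positive ground-state instance — with `ν = +e₅` the typed flux is EXACTLY
  `(μH[4] S⁴).toReal`, so the stub's constant is consistent with the area measure `Measure.comap ι μH[4]`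
  (which is the honest pull-back here: `measurableEmbedding_sliceMap`).

The mutated statements are written inline (no named `Prop`); everything else is the stub verbatim with
`M = S⁴`, `ι = sliceMap 0`.  Helpers only; no route item is asserted. [folklore]
-/

noncomputable section

open MeasureTheory Set Metric Module
open scoped Manifold ContDiff ENNReal Topology BigOperators RealInnerProductSpace

set_option linter.dupNamespace false

namespace Summit.SmoothPoincare4.SmoothPoincare4.Cruxes.CylinderRungTwo.KillingFlux.Negative

open Literature.Geometry.Riemannian
open Literature.Geometry.Lorentzian Literature.Geometry.Lorentzian.PseudoRiemannianMetric
open Literature.Geometry.Manifold.CylinderSlice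
open Literature.Geometry.Riemannian.SphericalCylinderEntropy (hausdorffMeasure_range_sliceMap isometry_sliceMap
  norm_padL hausdorffMeasure_sphere_four_pos hausdorffMeasure_sphere_four_lt_top)
open Literature.MeasureTheory.Hausdorff (cap le_euclideanHausdorffMeasure_cap_general)

/-! ### Tangent vectors of a slice are horizontal -/

/-- The differential of the slice embedding is `padL ∘ dι` (`ι : S⁴ ↪ ℝ⁵`). [folklore] -/
theorem mfderiv_sliceMap (c : ℝ) (x : Metric.sphere (0 : EuclideanSpace ℝ (Fin 5)) 1) :
    mfderiv (𝓡 4) (𝓡 6) (sliceMap c) x =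
      padL.comp (mfderiv (𝓡 4) 𝓘(ℝ, EuclideanSpace ℝ (Fin 5))
        (Subtype.val : Metric.sphere (0 : EuclideanSpace ℝ (Fin 5)) 1 → EuclideanSpace ℝ (Fin 5)) x) := by
  haveI : Fact (Module.finrank ℝ (EuclideanSpace ℝ (Fin 5)) = 4 + 1) := ⟨finrank_euclideanSpace_fin⟩
  have hval : ContMDiff (𝓡 4) 𝓘(ℝ, EuclideanSpace ℝ (Fin 5)) ∞
      (Subtype.val : Metric.sphere (0 : EuclideanSpace ℝ (Fin 5)) 1 → EuclideanSpace ℝ (Fin 5)) :=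
    contMDiff_coe_sphere
  have h1 : HasMFDerivAt (𝓡 4) 𝓘(ℝ, EuclideanSpace ℝ (Fin 5))
      (Subtype.val : Metric.sphere (0 : EuclideanSpace ℝ (Fin 5)) 1 → EuclideanSpace ℝ (Fin 5)) x
      (mfderiv (𝓡 4) 𝓘(ℝ, EuclideanSpace ℝ (Fin 5))
        (Subtype.val : Metric.sphere (0 : EuclideanSpace ℝ (Fin 5)) 1 → EuclideanSpace ℝ (Fin 5)) x) :=
    ((hval x).mdifferentiableAt (by simp)).hasMFDerivAt
  have h2 : HasFDerivAt (fun y : EuclideanSpace ℝ (Fin 5) => padL y + c • axis) padL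
      (x : EuclideanSpace ℝ (Fin 5)) :=
    padL.hasFDerivAt.add_const _
  have h3 := h2.hasMFDerivAt.comp x h1
  rw [sliceMap_eq_comp]
  exact h3.mfderiv

/-- Tangent vectors of a slice are horizontal: `⟪e₅, d(sliceMap) w⟫ = 0`. [folklore] -/
theorem inner_axis_mfderiv_sliceMap (c : ℝ) (x : Metric.sphere (0 : EuclideanSpace ℝ (Fin 5)) 1)
    (w : TangentSpace (𝓡 4) x) :
    ⟪(axis : EuclideanSpace ℝ (Fin 6)), (mfderiv (𝓡 4) (𝓡 6) (sliceMap c) x w : EuclideanSpace ℝ (Fin 6))⟫ = 0 := by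
  have h : mfderiv (𝓡 4) (𝓡 6) (sliceMap c) x w =
      padL (mfderiv (𝓡 4) 𝓘(ℝ, EuclideanSpace ℝ (Fin 5))
        (Subtype.val : Metric.sphere (0 : EuclideanSpace ℝ (Fin 5)) 1 → EuclideanSpace ℝ (Fin 5)) x w) :=
    DFunLike.congr_fun (mfderiv_sliceMap c x) w
  rw [h, axis, EuclideanSpace.inner_single_left]
  simp

/-- `±e₅` is a unit normal of every slice in the typed sense (`IsUnitNormal … 1`), for either sign. [folklore] -/
theorem isUnitNormal_sliceMap_of_eq_or (c : ℝ)
    (ν : Metric.sphere (0 : EuclideanSpace ℝ (Fin 5)) 1 → EuclideanSpace ℝ (Fin 6))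
    (hν : ∀ x, ν x = axis ∨ ν x = -axis) :
    (euclideanMetric (EuclideanSpace ℝ (Fin 6))).IsUnitNormal (𝓡 4) (sliceMap c) ν 1 := by
  refine ⟨fun y v => ?_, fun y => ?_⟩
  · rw [euclideanMetric_apply]
    have h0 := inner_axis_mfderiv_sliceMap c y v
    rcases hν y with h | h
    · rw [h]; exact h0
    · rw [h]
      change ⟪-(axis : EuclideanSpace ℝ (Fin 6)),
        (mfderiv (𝓡 4) (𝓡 6) (sliceMap c) y v : EuclideanSpace ℝ (Fin 6))⟫ = (0 : ℝ)
      rw [inner_neg_left, h0, neg_zero]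
  · rw [euclideanMetric_apply]
    rcases hν y with h | h
    · rw [h]
      change ⟪(axis : EuclideanSpace ℝ (Fin 6)), (axis : EuclideanSpace ℝ (Fin 6))⟫ = (1 : ℝ)
      simp [axis]
    · rw [h]
      change ⟪-(axis : EuclideanSpace ℝ (Fin 6)), -(axis : EuclideanSpace ℝ (Fin 6))⟫ = (1 : ℝ)
      simp [axis]

/-- A field with values `±e₅` is tangent to `N` along a slice. [folklore] -/
theorem tangent_sliceMap_of_eq_or (c : ℝ)
    (ν : Metric.sphere (0 : EuclideanSpace ℝ (Fin 5)) 1 → EuclideanSpace ℝ (Fin 6))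
    (hν : ∀ x, ν x = axis ∨ ν x = -axis) (x : Metric.sphere (0 : EuclideanSpace ℝ (Fin 5)) 1) :
    ∑ i : Fin 5, ν x (Fin.castSucc i) * sliceMap c x (Fin.castSucc i) = 0 := by
  have h0 : ∀ i : Fin 5, ν x (Fin.castSucc i) = 0 := fun i => by
    rcases hν x with h | h <;> rw [h] <;> simp [axis, castSucc_ne_five i]
  simp [h0]

/-! ### The pulled-back area measure of a slice -/

/-- The slice embedding is a measurable embedding (an isometry onto a closed set), so `Measure.comap (sliceMap c) μH[4]`
is the honest pull-back and not the junk value `0`. [folklore] -/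
theorem measurableEmbedding_sliceMap (c : ℝ) : MeasurableEmbedding (sliceMap c) :=
  (isometry_sliceMap c).isClosedEmbedding.measurableEmbedding

/-- The affine pad map `y ↦ (y, c)` is an isometry `ℝ⁵ → ℝ⁶`. [folklore] -/
theorem isometry_padAff (c : ℝ) :
    Isometry (fun y : EuclideanSpace ℝ (Fin 5) => padL y + c • axis) := by
  refine Isometry.of_dist_eq fun x y => ?_
  rw [dist_add_right, dist_eq_norm, ← map_sub, norm_padL, ← dist_eq_norm]

/-- `ι^* μH⁴` of a subset of `S⁴` is the `μH⁴`-measure of the subset viewed in `ℝ⁵`. [folklore] -/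
theorem comap_sliceMap_apply (c : ℝ) (s : Set (Metric.sphere (0 : EuclideanSpace ℝ (Fin 5)) 1)) :
    Measure.comap (sliceMap c) (μH[4] : Measure (EuclideanSpace ℝ (Fin 6))) s =
      μH[4] ((Subtype.val : Metric.sphere (0 : EuclideanSpace ℝ (Fin 5)) 1 → EuclideanSpace ℝ (Fin 5)) '' s) := by
  rw [(measurableEmbedding_sliceMap c).comap_apply, sliceMap_eq_comp, Set.image_comp,
    (isometry_padAff c).hausdorffMeasure_image (Or.inl (by norm_num))]

/-- Total mass of the pulled-back area measure of a slice = `μH⁴(S⁴ ⊂ ℝ⁵)`. [folklore] -/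
theorem comap_sliceMap_univ (c : ℝ) :
    Measure.comap (sliceMap c) (μH[4] : Measure (EuclideanSpace ℝ (Fin 6))) Set.univ =
      μH[4] (Metric.sphere (0 : EuclideanSpace ℝ (Fin 5)) 1) := by
  rw [(measurableEmbedding_sliceMap c).comap_apply, Set.image_univ, hausdorffMeasure_range_sliceMap]

/-- The pulled-back area measure of a slice is finite. [folklore] -/
theorem isFiniteMeasure_comap_sliceMap (c : ℝ) :
    IsFiniteMeasure (Measure.comap (sliceMap c) (μH[4] : Measure (EuclideanSpace ℝ (Fin 6)))) :=
  ⟨by rw [comap_sliceMap_univ]; exact hausdorffMeasure_sphere_four_lt_top⟩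

/-- Total mass of the pulled-back area measure, in `ℝ`. [folklore] -/
theorem measureReal_comap_sliceMap_univ (c : ℝ) :
    (Measure.comap (sliceMap c) (μH[4] : Measure (EuclideanSpace ℝ (Fin 6)))).real Set.univ =
      (μH[4] (Metric.sphere (0 : EuclideanSpace ℝ (Fin 5)) 1)).toReal := by
  rw [measureReal_def, comap_sliceMap_univ]

/-- A spherical cap of `S⁴ ⊂ ℝ⁵` of height `1/2` has positive `μH⁴`-measure (tree lower bound by the projected
disc). [folklore] -/
theorem hausdorffMeasure_cap_pos {v : EuclideanSpace ℝ (Fin 5)} (hv : ‖v‖ = 1) :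
    0 < μH[4] (cap v (1 / 2 : ℝ)) := by
  haveI : Fact (finrank ℝ (EuclideanSpace ℝ (Fin 5)) = 4 + 1) := ⟨finrank_euclideanSpace_fin⟩
  have hv0 : v ≠ 0 := fun h => by rw [h, norm_zero] at hv; exact zero_ne_one hv
  have hK : finrank ℝ (ℝ ∙ v)ᗮ = 4 := Submodule.finrank_orthogonal_span_singleton hv0
  have h := le_euclideanHausdorffMeasure_cap_general (E := EuclideanSpace ℝ (Fin 5)) hv hK (by norm_num)
    (c := (1 / 2 : ℝ)) (by norm_num)
  have h' : 0 < (μHE[4] : Measure (EuclideanSpace ℝ (Fin 5))) (cap v (1 / 2 : ℝ)) := by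
    refine lt_of_lt_of_le (pos_iff_ne_zero.2 (mul_ne_zero (pow_ne_zero _ ?_) ?_)) h
    · exact (ENNReal.ofReal_pos.2 (Real.sqrt_pos.2 (by norm_num))).ne'
    · refine (ENNReal.ofReal_pos.2 (div_pos (pow_pos (Real.sqrt_pos.2 Real.pi_pos) _)
        (Real.Gamma_pos_of_pos ?_))).ne'
      positivity
  rw [Measure.euclideanHausdorffMeasure_def, Measure.smul_apply, ENNReal.smul_def] at h'
  exact (ENNReal.mul_pos_iff.1 h').2

/-- The open hemisphere `H⁺ = {x₀ > 0}` of the slice has positive area (it contains the cap around `e₀`). [folklore] -/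
theorem comap_posHemi_pos :
    0 < Measure.comap (sliceMap 0) (μH[4] : Measure (EuclideanSpace ℝ (Fin 6)))
      {x : Metric.sphere (0 : EuclideanSpace ℝ (Fin 5)) 1 | 0 < (x : EuclideanSpace ℝ (Fin 5)) 0} := by
  rw [comap_sliceMap_apply]
  have hv : ‖(EuclideanSpace.single 0 1 : EuclideanSpace ℝ (Fin 5))‖ = 1 := by simp
  refine (hausdorffMeasure_cap_pos hv).trans_le (measure_mono ?_)
  rintro x ⟨hx1, hx2⟩
  refine ⟨⟨x, mem_sphere_zero_iff_norm.2 hx1⟩, ?_, rfl⟩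
  show 0 < x 0
  rw [EuclideanSpace.inner_single_left] at hx2
  simpa using (show (0 : ℝ) < x 0 by simpa using (lt_trans (by norm_num : (0:ℝ) < 1 / 2) hx2))

/-- The complement of `H⁺` has positive area (it contains the cap around `-e₀`). [folklore] -/
theorem comap_compl_posHemi_pos :
    0 < Measure.comap (sliceMap 0) (μH[4] : Measure (EuclideanSpace ℝ (Fin 6)))
      {x : Metric.sphere (0 : EuclideanSpace ℝ (Fin 5)) 1 | 0 < (x : EuclideanSpace ℝ (Fin 5)) 0}ᶜ := by
  rw [comap_sliceMap_apply]
  have hv : ‖(-(EuclideanSpace.single 0 1) : EuclideanSpace ℝ (Fin 5))‖ = 1 := by rw [norm_neg]; simp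
  refine (hausdorffMeasure_cap_pos hv).trans_le (measure_mono ?_)
  rintro x ⟨hx1, hx2⟩
  refine ⟨⟨x, mem_sphere_zero_iff_norm.2 hx1⟩, ?_, rfl⟩
  show ¬ (0 < x 0)
  rw [inner_neg_left, EuclideanSpace.inner_single_left] at hx2
  have : x 0 < 0 := by
    have h2 : (1 / 2 : ℝ) < -(x 0) := by simpa using hx2
    linarith
  exact not_lt.2 this.le

/-! ### The three facts -/

/-- **`FluxIdentity` (STUB 2 of line `killing-flux`) is FALSE without the hypothesis `Continuous ν`** — the statement
below is the stub verbatim with `Continuous ν →` deleted.  Witness: `M = S⁴`, `ι = sliceMap 0`, `ν = +e₅` on the open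
hemisphere `{x₀ > 0}` and `-e₅` elsewhere: the flux is `μ(H⁺) - μ(S⁴ ∖ H⁺)`, and both parts have positive area.
[folklore] -/
theorem fluxIdentityWithoutContinuous_false :
    ¬ (∀ (M : Type) [TopologicalSpace M] [T2Space M] [SecondCountableTopology M]
        [ChartedSpace (EuclideanSpace ℝ (Fin 4)) M] [IsManifold (𝓡 4) ∞ M] [CompactSpace M] [ConnectedSpace M]
        [MeasurableSpace M] [BorelSpace M]
        (ι : M → EuclideanSpace ℝ (Fin 6)), Manifold.IsSmoothEmbedding (𝓡 4) (𝓡 6) ∞ ι →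
        (∀ x, ∑ i : Fin 5, ι x (Fin.castSucc i) ^ 2 = 1) →
        (∃ R : ℝ, ∀ a b : EuclideanSpace ℝ (Fin 6), ∑ i : Fin 5, a (Fin.castSucc i) ^ 2 = 1 →
          ∑ i : Fin 5, b (Fin.castSucc i) ^ 2 = 1 → a 5 ≤ -R → R ≤ b 5 →
          ¬ JoinedIn ({z : EuclideanSpace ℝ (Fin 6) | ∑ i : Fin 5, z (Fin.castSucc i) ^ 2 = 1} \ Set.range ι) a b) →
        ∀ ν : M → EuclideanSpace ℝ (Fin 6),
          (euclideanMetric (EuclideanSpace ℝ (Fin 6))).IsUnitNormal (𝓡 4) ι ν 1 →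
          (∀ x, ∑ i : Fin 5, ν x (Fin.castSucc i) * ι x (Fin.castSucc i) = 0) →
          |∫ x, ν x 5 ∂(Measure.comap ι (μH[4] : Measure (EuclideanSpace ℝ (Fin 6))))| =
            (μH[4] (Metric.sphere (0 : EuclideanSpace ℝ (Fin 5)) 1)).toReal) := by
  intro h
  haveI : Fact (finrank ℝ (EuclideanSpace ℝ (Fin 5)) = 4 + 1) := ⟨finrank_euclideanSpace_fin⟩
  haveI : PathConnectedSpace (Metric.sphere (0 : EuclideanSpace ℝ (Fin 5)) 1) :=
    Literature.Topology.FourManifolds.pathConnectedSpace_sphere_four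
  haveI := isFiniteMeasure_comap_sliceMap 0
  -- the witness field and the hemisphere
  set H : Set (Metric.sphere (0 : EuclideanSpace ℝ (Fin 5)) 1) :=
    {x | 0 < (x : EuclideanSpace ℝ (Fin 5)) 0} with hH
  set ν : Metric.sphere (0 : EuclideanSpace ℝ (Fin 5)) 1 → EuclideanSpace ℝ (Fin 6) :=
    fun x => if 0 < (x : EuclideanSpace ℝ (Fin 5)) 0 then axis else -axis with hνdef
  have hν : ∀ x, ν x = axis ∨ ν x = -axis := fun x => by
    simp only [hνdef]; split_ifs
    · exact Or.inl rfl
    · exact Or.inr rfl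
  have hHm : MeasurableSet H :=
    (isOpen_lt continuous_const ((EuclideanSpace.proj (0 : Fin 5)).continuous.comp
      continuous_subtype_val)).measurableSet
  have hν5 : ∀ x, ν x 5 = H.indicator (fun _ => (1 : ℝ)) x - Hᶜ.indicator (fun _ => (1 : ℝ)) x := by
    intro x
    by_cases hx : x ∈ H
    · have hx' : 0 < (x : EuclideanSpace ℝ (Fin 5)) 0 := hx
      simp [hνdef, hx, hx', axis]
    · have hx' : ¬ 0 < (x : EuclideanSpace ℝ (Fin 5)) 0 := hx
      simp [hνdef, hx, hx', axis]
  have key := h (Metric.sphere (0 : EuclideanSpace ℝ (Fin 5)) 1) (sliceMap 0) (isSmoothEmbedding_sliceMap 0)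
    (sum_sq_sliceMap 0) (separatesEnds_of_slice_subset (c := 0) (by rw [range_sliceMap])) ν
    (isUnitNormal_sliceMap_of_eq_or 0 ν hν) (tangent_sliceMap_of_eq_or 0 ν hν)
  -- the flux of the witness
  have hflux : ∫ x, ν x 5 ∂(Measure.comap (sliceMap 0) (μH[4] : Measure (EuclideanSpace ℝ (Fin 6)))) =
      (Measure.comap (sliceMap 0) (μH[4] : Measure (EuclideanSpace ℝ (Fin 6)))).real H -
        (Measure.comap (sliceMap 0) (μH[4] : Measure (EuclideanSpace ℝ (Fin 6)))).real Hᶜ := by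
    have h1 : Integrable (H.indicator fun _ => (1 : ℝ))
        (Measure.comap (sliceMap 0) (μH[4] : Measure (EuclideanSpace ℝ (Fin 6)))) :=
      (integrable_const 1).indicator hHm
    have h2 : Integrable (Hᶜ.indicator fun _ => (1 : ℝ))
        (Measure.comap (sliceMap 0) (μH[4] : Measure (EuclideanSpace ℝ (Fin 6)))) :=
      (integrable_const 1).indicator hHm.compl
    simp_rw [hν5]
    rw [integral_sub h1 h2, integral_indicator_const _ hHm, integral_indicator_const _ hHm.compl, smul_eq_mul,
      mul_one, smul_eq_mul, mul_one]
  rw [hflux] at key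
  have htot : (Measure.comap (sliceMap 0) (μH[4] : Measure (EuclideanSpace ℝ (Fin 6)))).real H +
      (Measure.comap (sliceMap 0) (μH[4] : Measure (EuclideanSpace ℝ (Fin 6)))).real Hᶜ =
        (μH[4] (Metric.sphere (0 : EuclideanSpace ℝ (Fin 5)) 1)).toReal := by
    rw [measureReal_add_measureReal_compl hHm, measureReal_comap_sliceMap_univ]
  have hpos : 0 < (Measure.comap (sliceMap 0) (μH[4] : Measure (EuclideanSpace ℝ (Fin 6)))).real H :=
    ENNReal.toReal_pos comap_posHemi_pos.ne' (measure_ne_top _ _)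
  have hneg : 0 < (Measure.comap (sliceMap 0) (μH[4] : Measure (EuclideanSpace ℝ (Fin 6)))).real Hᶜ :=
    ENNReal.toReal_pos comap_compl_posHemi_pos.ne' (measure_ne_top _ _)
  rw [← htot] at key
  rcases abs_cases ((Measure.comap (sliceMap 0) (μH[4] : Measure (EuclideanSpace ℝ (Fin 6)))).real H -
      (Measure.comap (sliceMap 0) (μH[4] : Measure (EuclideanSpace ℝ (Fin 6)))).real Hᶜ) with ⟨hc, -⟩ | ⟨hc, -⟩
  · rw [hc] at key; linarith
  · rw [hc] at key; linarith

/-- **`FluxIdentity` (STUB 2 of line `killing-flux`) is FALSE without the absolute value** — the statement below is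
the stub verbatim with `|·|` deleted.  Witness: the slice with the continuous unit normal `-e₅` (flux `-μH⁴(S⁴)`):
the sign of the flux is the orientation of `ν`. [folklore] -/
theorem fluxIdentityWithoutAbs_false :
    ¬ (∀ (M : Type) [TopologicalSpace M] [T2Space M] [SecondCountableTopology M]
        [ChartedSpace (EuclideanSpace ℝ (Fin 4)) M] [IsManifold (𝓡 4) ∞ M] [CompactSpace M] [ConnectedSpace M]
        [MeasurableSpace M] [BorelSpace M]
        (ι : M → EuclideanSpace ℝ (Fin 6)), Manifold.IsSmoothEmbedding (𝓡 4) (𝓡 6) ∞ ι →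
        (∀ x, ∑ i : Fin 5, ι x (Fin.castSucc i) ^ 2 = 1) →
        (∃ R : ℝ, ∀ a b : EuclideanSpace ℝ (Fin 6), ∑ i : Fin 5, a (Fin.castSucc i) ^ 2 = 1 →
          ∑ i : Fin 5, b (Fin.castSucc i) ^ 2 = 1 → a 5 ≤ -R → R ≤ b 5 →
          ¬ JoinedIn ({z : EuclideanSpace ℝ (Fin 6) | ∑ i : Fin 5, z (Fin.castSucc i) ^ 2 = 1} \ Set.range ι) a b) →
        ∀ ν : M → EuclideanSpace ℝ (Fin 6), Continuous ν →
          (euclideanMetric (EuclideanSpace ℝ (Fin 6))).IsUnitNormal (𝓡 4) ι ν 1 →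
          (∀ x, ∑ i : Fin 5, ν x (Fin.castSucc i) * ι x (Fin.castSucc i) = 0) →
          ∫ x, ν x 5 ∂(Measure.comap ι (μH[4] : Measure (EuclideanSpace ℝ (Fin 6)))) =
            (μH[4] (Metric.sphere (0 : EuclideanSpace ℝ (Fin 5)) 1)).toReal) := by
  intro h
  haveI : Fact (finrank ℝ (EuclideanSpace ℝ (Fin 5)) = 4 + 1) := ⟨finrank_euclideanSpace_fin⟩
  haveI : PathConnectedSpace (Metric.sphere (0 : EuclideanSpace ℝ (Fin 5)) 1) :=
    Literature.Topology.FourManifolds.pathConnectedSpace_sphere_four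
  have hν : ∀ x : Metric.sphere (0 : EuclideanSpace ℝ (Fin 5)) 1,
      (fun _ : Metric.sphere (0 : EuclideanSpace ℝ (Fin 5)) 1 => -(axis : EuclideanSpace ℝ (Fin 6))) x = axis ∨
      (fun _ : Metric.sphere (0 : EuclideanSpace ℝ (Fin 5)) 1 => -(axis : EuclideanSpace ℝ (Fin 6))) x = -axis :=
    fun _ => Or.inr rfl
  have key := h (Metric.sphere (0 : EuclideanSpace ℝ (Fin 5)) 1) (sliceMap 0) (isSmoothEmbedding_sliceMap 0)
    (sum_sq_sliceMap 0) (separatesEnds_of_slice_subset (c := 0) (by rw [range_sliceMap])) (fun _ => -axis)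
    continuous_const (isUnitNormal_sliceMap_of_eq_or 0 _ hν) (tangent_sliceMap_of_eq_or 0 _ hν)
  have h5 : (-(axis : EuclideanSpace ℝ (Fin 6))) 5 = -1 := by simp [axis]
  simp only [h5, integral_const, smul_eq_mul, mul_neg, mul_one, measureReal_comap_sliceMap_univ] at key
  have hvol : 0 < (μH[4] (Metric.sphere (0 : EuclideanSpace ℝ (Fin 5)) 1)).toReal :=
    ENNReal.toReal_pos hausdorffMeasure_sphere_four_pos.ne' hausdorffMeasure_sphere_four_lt_top.ne
  linarith

/-- **Ground-state instance of the stub (positive consistency check of its constant).**  For the slice with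
`ν = +e₅` the typed flux integral IS `(μH[4] S⁴).toReal`: the normalisation of `Measure.comap ι μH[4]` (area
measure in `ℝ⁶`) matches `μH[4]` of `S⁴ ⊂ ℝ⁵`. [folklore] -/
theorem flux_sliceMap_axis (c : ℝ) :
    |∫ x, (fun _ : Metric.sphere (0 : EuclideanSpace ℝ (Fin 5)) 1 => (axis : EuclideanSpace ℝ (Fin 6))) x 5
        ∂(Measure.comap (sliceMap c) (μH[4] : Measure (EuclideanSpace ℝ (Fin 6))))| =
      (μH[4] (Metric.sphere (0 : EuclideanSpace ℝ (Fin 5)) 1)).toReal := by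
  have h5 : (axis : EuclideanSpace ℝ (Fin 6)) 5 = 1 := by simp [axis]
  simp only [h5, integral_const, smul_eq_mul, mul_one, measureReal_comap_sliceMap_univ]
  exact abs_of_nonneg ENNReal.toReal_nonneg

end Summit.SmoothPoincare4.SmoothPoincare4.Cruxes.CylinderRungTwo.KillingFlux.Negative

end
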